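import Summits.ResolutionOfSingularities.ResolutionOfSingularities.Theorems.FrobeniusClosingPatchingRelPerfectDepthPhaseCLocalGamePatchReduction
import Literature.AlgebraicGeometry.Resolution.BlowupRestrictOpen
import HarnessLib

/-!
# Crux `PatchingRelPerfect` (stmt-ResolutionOfSingularities-16161), chain W5.2 — F7(β) (β-AX) X3 C-I (G2) engine:
# SMALL TOOLS FOR THE GLOBAL DRIVER (brick (b3b) `DriverPrelude`)

[OURS · L1 W5.2 · res-D-pv-046 ENGINE NOTE 4 2026-08-27T21:48:11Z CLAIM 1, res-L1-w52-lead-1 RECORD R13-4 (1); line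
`Cruxes/PatchingRelPerfect/Lines/closed_point_slice.lean`.]  Replaces the role of NO printed item; NOT a statement of the manuscript under review;
fact-free; def-free.  AI-written; AI review is weaker than expert review.

The driver of the (H-snc) engine keeps, on every presented piece `D ⊆ T`, the Route-K dictionary `MonomialCleanup.GameInv (st D) (𝓛|_D) 𝒦_D id`
for the FULL global letter list `𝓛` with the IDENTITY labelling (`B = range |𝓛|` for all pieces).  This file collects the book-keeping it needs:

* `gameInv_congr_lab`, `labMove_id` — after a move the labelling `labMove (𝓛|_D) id |𝓛|` is again the identity on positions;
* `posOf_id` — with the identity labelling the positions of `J ⊆ range |𝓛|` are `J` itself;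
* `comap_finsetSup_image_nthSheaf` — the global stratum `⨆{𝓛[k] : k ∈ J}` restricts to the stratum of the restricted letters;
* `subset_support_marked_of_forall_le_weight` — weights `≥ m` on `J` put the `J`-stratum inside `Sing(Σ𝒦, m)` (legality of the good pieces;
  p572454's `forall_le_weightAt_of_mem_support_centre` without `J ∈ Str`);
* `mem_support_marked_comap_iff` — the marked support restricts along open immersions;
* `exists_globalRows` — rows over the restricted letters `𝓛|_D` come from rows over `𝓛` (to state END in the `IsEndNear` format).

## References (for the mathematics; nothing here is a statement of the manuscript under review)
* J. Kollár, *Lectures on Resolution of Singularities* (2007), (3.111) Step 3, Def. 3.65. [Kollar2007]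
* E. Bierstone, P. Milman, *Desingularization of toric and binomial varieties*, J. Algebraic Geom. 15 (2006), Lemma 8.7. [BierstoneMilman2006]
-/

-- `Summit.<Summit>.<Sub>.Theorems` with `Sub = Summit` (single-conjunct summit, D-0017)
set_option linter.dupNamespace false

noncomputable section

open CategoryTheory AlgebraicGeometry TopologicalSpace IsLocalRing
open Literature.AlgebraicGeometry.Resolution

namespace Summit.ResolutionOfSingularities.ResolutionOfSingularities.Theorems

namespace MonomialCleanup

open DepthTargets (monomialSum monomialSum_nil monomialSum_cons)
open PolyhedraGame (State move weight weight_mono)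

universe u

variable {X : Scheme.{u}}

/-! ## §1 Labellings -/

/-- **The dictionary only sees the labelling on the positions.** [folklore] -/
theorem gameInv_congr_lab {s : State} {Es : List X.IdealSheafData} {𝒦 : List (List (X.IdealSheafData × ℕ))} {lab lab' : ℕ → ℕ}
    (hinv : GameInv s Es 𝒦 lab) (h : ∀ k, k < Es.length → lab' k = lab k) : GameInv s Es 𝒦 lab' := by
  have himg : ∀ S : Finset ℕ, (∀ k ∈ S, k < Es.length) → S.image lab' = S.image lab := fun S hS =>
    Finset.image_congr fun k hk => h k (hS k (Finset.mem_coe.mp hk))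
  have hagree : ∀ A α, Agree Es lab A α → Agree Es lab' A α := fun A α hagr k hk hp => by
    rw [h k hk]; exact hagr k hk hp
  refine ⟨hinv.snc, hinv.bd, hinv.pd, fun k k' hk hk' heq => hinv.lab_inj k k' hk hk' (by rw [← h k hk, ← h k' hk']; exact heq), ?_,
    hinv.str_B, hinv.supp, fun S hS hx => ?_, fun A hA => ?_, fun α hα => ?_⟩
  · rw [hinv.B_eq]
    exact (himg _ fun k hk => Finset.mem_range.mp hk).symm
  · rw [himg S hS]; exact hinv.str S hS hx
  · obtain ⟨α, hα, hagr⟩ := hinv.fwd A hA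
    exact ⟨α, hα, hagree A α hagr⟩
  · obtain ⟨A, hA, hagr⟩ := hinv.bwd α hα
    exact ⟨A, hA, hagree A α hagr⟩

/-- The positional move of the identity labelling is the identity on the new positions. [folklore] -/
theorem labMove_id (Es : List X.IdealSheafData) : ∀ k, k < (Es ++ [(⊤ : X.IdealSheafData)]).length → labMove Es id Es.length k = id k := by
  intro k hk
  rw [List.length_append, List.length_singleton] at hk
  rcases Nat.lt_succ_iff_lt_or_eq.mp hk with hk | rfl
  · exact labMove_lt hk
  · exact labMove_length

/-- The same, for any list of the new length (e.g. the transformed letters `Es.map st ++ [E]`). [folklore] -/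
theorem labMove_id_of_length {Y : Scheme.{u}} (Es : List X.IdealSheafData) (Es' : List Y.IdealSheafData)
    (hlen : Es'.length = Es.length + 1) : ∀ k, k < Es'.length → labMove Es id Es.length k = id k := by
  intro k hk
  rw [hlen] at hk
  rcases Nat.lt_succ_iff_lt_or_eq.mp hk with hk | rfl
  · exact labMove_lt hk
  · exact labMove_length

/-- With the identity labelling, the positions of `J ⊆ range |Es|` are `J`. [folklore] -/
theorem posOf_id {Es : List X.IdealSheafData} {J : Finset ℕ} (hJ : J ⊆ Finset.range Es.length) : posOf Es id J = J := by
  ext k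
  rw [mem_posOf_iff]
  exact ⟨fun h => h.2, fun h => ⟨Finset.mem_range.mp (hJ h), h⟩⟩

/-! ## §2 Strata and restriction -/

open Classical in
/-- **Pull-back commutes with the stratum of a set of positions**: `(⨆{Es[k] : k ∈ J})|_f = ⨆{(Es|_f)[k] : k ∈ J}`. [folklore] -/
theorem comap_finsetSup_image_nthSheaf {Y : Scheme.{u}} (f : Y ⟶ X) (Es : List X.IdealSheafData) {J : Finset ℕ}
    (hJ : ∀ k ∈ J, k < Es.length) :
    ((J.image (nthSheaf Es)).sup id).comap f = (J.image (nthSheaf (Es.map fun F => F.comap f))).sup id := by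
  classical
  induction J using Finset.induction_on with
  | empty => rw [Finset.image_empty, Finset.image_empty, Finset.sup_empty, Finset.sup_empty, Scheme.IdealSheafData.comap_bot]
  | insert k J hkJ ih =>
    have hk : k < Es.length := hJ k (Finset.mem_insert_self k J)
    rw [Finset.image_insert, Finset.image_insert, Finset.sup_insert, Finset.sup_insert, id, id,
      Scheme.IdealSheafData.comap_sup, ih fun k' hk' => hJ k' (Finset.mem_insert_of_mem hk'), nthSheaf_map Es _ hk]

/-- **The marked support restricts along open immersions**: `v ∈ Sing(K|_V, m) ↔ f v ∈ Sing(K, m)`. [folklore] -/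
theorem mem_support_marked_comap_iff {V : Scheme.{u}} (f : V ⟶ X) [IsOpenImmersion f] (K : X.IdealSheafData) (m : ℕ) (v : V) :
    v ∈ (⟨K.comap f, [], m⟩ : MarkedIdeal V).support ↔ f v ∈ (⟨K, [], m⟩ : MarkedIdeal X).support := by
  show (m : ℕ∞) ≤ idealOrder (K.comap f) v ↔ (m : ℕ∞) ≤ idealOrder K (f v)
  rw [idealOrder_comap_of_isOpenImmersion]

open Classical in
/-- **Weights `≥ m` on `J` put the `J`-stratum inside `Sing(Σ𝒦, m)`** (p572454's `forall_le_weightAt_of_mem_support_centre` with the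
hypothesis `J ∈ Str` relaxed to `J ⊆ B`). [cite: Kollar2007, Def. 3.65] -/
theorem subset_support_marked_of_forall_le_weight {s : State} {Es : List X.IdealSheafData} {𝒦 : List (List (X.IdealSheafData × ℕ))}
    {lab : ℕ → ℕ} (hinv : GameInv s Es 𝒦 lab) {m : ℕ} {J : Finset ℕ} (hJB : J ⊆ s.B) (hJw : ∀ α ∈ s.A, m ≤ weight J α) :
    ((((posOf Es lab J).image (nthSheaf Es)).sup id).support : Set X) ⊆ (⟨monomialSum 𝒦, [], m⟩ : MarkedIdeal X).support := by
  intro x hx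
  refine (PolyhedraGame.RouteK.mem_support_monomialSum_marked_iff 𝒦 (fun B hB => by rw [hinv.bd B hB]; exact hinv.snc) [] m x).mpr
    fun A hA => ?_
  set S : Finset ℕ := (Finset.range Es.length).filter fun k => x ∈ (nthSheaf Es k).support with hS
  have hSiff : ∀ k, k ∈ S ↔ k < Es.length ∧ x ∈ (nthSheaf Es k).support := fun k => by
    rw [hS, Finset.mem_filter, Finset.mem_range]
  have hxP : ∀ k ∈ posOf Es lab J, x ∈ (nthSheaf Es k).support := fun k hk =>
    (mem_support_finsetSup_iff _ x).mp hx _ (Finset.mem_image_of_mem _ hk)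
  have hPS : posOf Es lab J ⊆ S := fun k hk => (hSiff k).mpr ⟨(mem_posOf_iff.mp hk).1, hxP k hk⟩
  obtain ⟨α, hα, hagr⟩ := hinv.fwd A hA
  have h1 : weight J α ≤ weight (S.image lab) α := by
    rw [← image_lab_posOf hinv hJB]
    exact weight_mono (Finset.image_subset_image hPS) α
  rw [← hinv.weight_image_lab_eq_weightAt hA hagr hSiff]
  exact (hJw α hα).trans h1

/-! ## §3 Rows over restricted letters come from global rows -/

/-- One row: an exponent list on the restricted letters `Λ|_f` is the restriction of an exponent list on `Λ` (same exponents). [folklore] -/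
theorem exists_globalRow {Y : Scheme.{u}} (f : Y ⟶ X) (Λ : List X.IdealSheafData) (A : List (Y.IdealSheafData × ℕ))
    (hA : boundaryOf A = Λ.map fun F => F.comap f) :
    ∃ A' : List (X.IdealSheafData × ℕ), boundaryOf A' = Λ ∧ (A'.map fun p => (p.1.comap f, p.2)) = A := by
  induction Λ generalizing A with
  | nil =>
    refine ⟨[], rfl, ?_⟩
    rw [List.map_nil] at hA
    have h := length_boundaryOf A
    rw [hA, List.length_nil] at h
    rw [List.map_nil, eq_comm, ← List.length_eq_zero_iff]
    exact h.symm
  | cons F Λ ih =>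
    cases A with
    | nil =>
      have h := length_boundaryOf ([] : List (Y.IdealSheafData × ℕ))
      rw [hA] at h
      simp at h
    | cons p A =>
      have hb : boundaryOf (p :: A) = p.1 :: boundaryOf A := by simp [boundaryOf]
      rw [hb, List.map_cons, List.cons.injEq] at hA
      obtain ⟨A', hA', hmap⟩ := ih A hA.2
      refine ⟨(F, p.2) :: A', ?_, ?_⟩
      · simp only [boundaryOf, List.map_cons] at hA' ⊢
        rw [hA']
      · rw [List.map_cons, hmap, ← hA.1]

/-- **Rows over the restricted letters come from global rows**: if every row of `𝒦` lives on `Λ|_f`, then `𝒦` is the restriction of a row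
list `𝒦'` on `Λ` of the same length, and `Σ𝒦 = (Σ𝒦')|_f`. [folklore] -/
theorem exists_globalRows {Y : Scheme.{u}} (f : Y ⟶ X) (Λ : List X.IdealSheafData) (𝒦 : List (List (Y.IdealSheafData × ℕ)))
    (hbd : ∀ A ∈ 𝒦, boundaryOf A = Λ.map fun F => F.comap f) :
    ∃ 𝒦' : List (List (X.IdealSheafData × ℕ)), (∀ A' ∈ 𝒦', boundaryOf A' = Λ) ∧
      (𝒦'.map fun A' => A'.map fun p => (p.1.comap f, p.2)) = 𝒦 ∧ 𝒦'.length = 𝒦.length ∧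
      (monomialSum 𝒦').comap f = monomialSum 𝒦 := by
  induction 𝒦 with
  | nil => exact ⟨[], fun A h => absurd h List.not_mem_nil, rfl, rfl, by
      rw [monomialSum_nil, monomialSum_nil, Scheme.IdealSheafData.comap_bot]⟩
  | cons A 𝒦 ih =>
    obtain ⟨𝒦', hbd', hmap, hlen, hsum⟩ := ih fun B hB => hbd B (List.mem_cons_of_mem _ hB)
    obtain ⟨A', hA', hAmap⟩ := exists_globalRow f Λ A (hbd A List.mem_cons_self)
    refine ⟨A' :: 𝒦', fun B hB => ?_, by rw [List.map_cons, hAmap, hmap], by rw [List.length_cons, List.length_cons, hlen], ?_⟩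
    · rcases List.mem_cons.mp hB with rfl | hB
      · exact hA'
      · exact hbd' B hB
    · rw [DepthMultiHost.comap_monomialSum_map, List.map_cons, hAmap, hmap]

end MonomialCleanup

end Summit.ResolutionOfSingularities.ResolutionOfSingularities.Theorems

end
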